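import Summits.QuantumFields.YangMills.Theorems.FluctuationComparisonRegPrIntLS2BetaChartReadSecondOrder
import HarnessLib

/-!
# S2β · (β-5) GLOBAL LINEAR SIZES OF THE ONE-STEP CHART-READ VALUE AND DERIVATIVE: `‖↑(ψ_{U₀}(X) c)‖ ≤ (560∕ρ)·ℓ·‖X^{(c)}‖` AND `‖↑((Dψ_{U₀}(0)X) c)‖ ≤ 216·ℓ·‖X^{(c)}‖` FOR
# EVERY `X` — the sizes the THIRD-ORDER chart terms of the quaternion-read dictionary (Q8 `‖y‖³∕6`, `‖DΨ(0)((sinc − 1)•X)‖`) are priced with, for ARBITRARY fibre mates ([Balaban1985Averaging] (120)–(126))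

Cell `ym3-torus` (YM ladder rung R3 = continuum `SU(2)` Yang–Mills on the three-torus at fixed lattice data — a RUNG: NOT d = 4, NOT infinite volume, NOT a mass gap,
NOT Clay).  Width seat `ym3-torus-px13` (gen 26); crux `stmt-QuantumFields-20520`, LINE g18-1 S2β, pairing lane, AVG₂♭-ax_q ∕ TAYLOR♭_q route; sequel of (β-3) ✓p828183 (§5: `‖↑(Λ g)‖ ≤ log 2`
always; `‖↑((Dψ(0)X) c)‖ ≤ 216ℓ‖X‖`).  px16 g22's local text of record `hLoc` quantifies over chords with `‖ζ ℓ‖ ≤ π` — NO small radius — so every per-bracket size must hold for EVERY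
`X`; this file supplies the two LINEAR sizes in that regime, in the global and in the two-block-local (`X^{(c)}`) currencies.  `--kind proof --supports stmt-QuantumFields-20520 --as helper`,
count-neutral, DEFINITION-FREE.

WHAT IS PROVED (sorry-free; hypotheses as (β-3): `0 < ρ ≤ innerRadius` (`= 1∕3` for `SU(2)`), loop guard `dist1 (loopHol U₀ c i) ≤ α` at every coarse bond, `4α ≤ ρ`; `ℓ = (d+2)L`;
`X^{(c)} := X·𝟙{blockOf b.src ∈ {c.src, c.tgt}}`).
* §1 ★★`norm_coe_chartRead_le_global` — EVERY `X`: **`‖↑(ψ_{U₀}(X) c)‖ ≤ (560∕ρ)·ℓ·‖X‖`** (inside `ρ∕(800ℓ)`: (β-2) ✓`norm_coe_chartRead_le` `≤ 54ℓ(e^{‖X‖} − 1) ≤ 108ℓ‖X‖`; outside: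
  `log 2 ≤ 0.7 ≤ 0.7·‖X‖∕r₀ = (560∕ρ)ℓ‖X‖`); ★★`norm_coe_chartRead_le_local_global` (`≤ (560∕ρ)·ℓ·‖X^{(c)}‖`, `j + 1 ≤ m + K`); ★★`norm_coe_chartRead_le_local_SU2` (**`≤ 1680·ℓ·‖X^{(c)}‖`**, guard `α ≤ 1∕12`).
* §2 ★★`norm_coe_fderiv_chartRead_le_local` — EVERY `X`: **`‖↑((Dψ_{U₀}(0) X) c)‖ ≤ 216·ℓ·‖X^{(c)}‖`** ((β-3) ✓`norm_coe_fderiv_chartRead_le` at the truncation + (D1-loc) ✓`fderiv_chartRead_apply_local`);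
  ★★`norm_coe_fderiv_chartRead_le_local_SU2` (the same on `SU(2)`, guard `α ≤ 1∕12`, no `ρ`).

HONEST.  Triangle-inequality bookkeeping over (β-2)∕(β-3)∕(D1-loc); nothing of Bałaban's; AVG₂♭-ax_q ∕ TAYLOR♭_q ∕ `hLoc`, «MULT♭-ax»∕«CRIT-ax», (D-ax), GAP♯∘ (registry UNTOUCHED),
the five REGISTERED stubs, S2β, crux 20520, 19936, 19200, `YM3TorusSU2` — NOT proved; rung R3 = SU(2) YM₃ on T³ at fixed lattice data — NOT d = 4, NOT infinite volume, NOT a mass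
gap, NOT Clay; the Yang–Mills mass gap is NOT proved.  Axioms standard.

References: [Balaban1985Averaging] CMP **98** (1985) Prop. 3 (120)–(126) p.36; [Balaban1987RG1] CMP **109** (1987) (0.4), (0.8) p.253.
-/

set_option autoImplicit false

noncomputable section

open scoped Matrix.Norms.L2Operator Topology
open Filter Set Function Metric

namespace Summit.QuantumFields.YangMills.Theorems.FluctuationComparisonRegPrIntLS2BetaChartReadGlobalSizes

open Literature.MathematicalPhysics.QuantumFieldTheory.Balaban1983to89
open Literature.MathematicalPhysics.QuantumFieldTheory.Balaban1983to89.HaarExponentialChart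
open Literature.MathematicalPhysics.QuantumFieldTheory.Balaban1983to89.HaarExponentialChart.IsChartRep
open Literature.MathematicalPhysics.QuantumFieldTheory.Balaban1983to89.BlockAveraging (Small Idx avgFun loopHol off corr)
open Literature.MathematicalPhysics.QuantumFieldTheory.Balaban1983to89.ExpMeanLog (eml expMeanLogSU deltaSU deltaSU_pos)
open Literature.MathematicalPhysics.QuantumFieldTheory.Balaban1983to89.Node00
open Summit.QuantumFields.YangMills.BalabanUVNodes.N09ChartReadAveragingSmooth
open Summit.QuantumFields.YangMills.Theorems.FluctuationComparisonRegPrIntLS2BetaChartReadCplxExtension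
open Summit.QuantumFields.YangMills.Theorems.FluctuationComparisonRegPrIntLS2BetaChartReadCplxAnalytic
open Summit.QuantumFields.YangMills.Theorems.FluctuationComparisonRegPrIntLS2BetaChartReadSecondOrder
open Summit.QuantumFields.YangMills.Theorems.FluctuationComparisonRegPrIntLS2BetaChartReadDerivLocal (chartRead_apply_local fderiv_chartRead_apply_local)

variable {P : Params} {j : ℕ} {N : ℕ} [NeZero N] (U₀ : GaugeField P j (SU N))

/-! ## §1 The value: `‖↑(ψ_{U₀}(X) c)‖ ≤ (560∕ρ)·ℓ·‖X‖` for every `X`, and its two-block-local and `SU(2)` editions -/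

section Value

/-- ★★ **GLOBAL LINEAR SIZE OF THE CHART-READ VALUE**: for `U₀` in the loop `α`-guard at every coarse bond (`4α ≤ ρ ≤` inner radius, `0 < ρ`) and EVERY direction `X`:
`‖↑(ψ_{U₀}(X) c)‖ ≤ (560∕ρ)·ℓ·‖X‖` (polydisc: `54ℓ(e^{‖X‖} − 1) ≤ 108ℓ‖X‖`; outside: `log 2 ≤ 0.7·‖X‖∕r₀`, `r₀ = ρ∕(800ℓ)`). [cite: Balaban1985Averaging, Prop. 3 (120)-(121) p.36] -/
theorem norm_coe_chartRead_le_global {α ρ : ℝ} (hρ0 : 0 < ρ) (hρ : ρ ≤ innerRadius (specialUnitaryLogChart (Fin N)))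
    (hα : ∀ c i, dist1 (loopHol U₀ c i) ≤ α) (hα4 : 4 * α ≤ ρ) (X : PBond P j → (specialUnitaryLogChart (Fin N)).lie) (c : PBond P (j + 1)) :
    ‖(((isChartRep_specialUnitaryGroup (n := Fin N)).logChart (avgFun (expMeanLogSU (n := Fin N)) (fun b => (isChartRep_specialUnitaryGroup (n := Fin N)).expChart (X b) * U₀ b) c * (avgFun (expMeanLogSU (n := Fin N)) U₀ c)⁻¹) : (specialUnitaryLogChart (Fin N)).lie) : Matrix (Fin N) (Fin N) ℂ)‖ ≤ 560 / ρ * (((P.d + 2) * P.L : ℕ) : ℝ) * ‖X‖ := by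
  have hℓ1 : (1 : ℝ) ≤ (((P.d + 2) * P.L : ℕ) : ℝ) := by exact_mod_cast Nat.one_le_iff_ne_zero.2 (Nat.mul_ne_zero (by omega) P.L_pos.ne')
  have hρ3 : ρ ≤ 1 / 3 := hρ.trans innerRadius_le_third
  have hX0 : 0 ≤ ‖X‖ := norm_nonneg X
  set r₀ : ℝ := ρ / (800 * (((P.d + 2) * P.L : ℕ) : ℝ)) with hr₀
  have hr₀0 : 0 < r₀ := by rw [hr₀]; positivity
  by_cases hX : ‖X‖ ≤ r₀
  · -- inside the polydisc: `54ℓ(e^{‖X‖} − 1) ≤ 108ℓ‖X‖ ≤ (560∕ρ)ℓ‖X‖`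
    have hX1 : ‖X‖ ≤ 1 := hX.trans (by rw [hr₀, div_le_one (by positivity)]; nlinarith)
    have hea : Real.exp ‖X‖ - 1 ≤ 2 * ‖X‖ := by
      have h3 := Real.abs_exp_sub_one_sub_id_le (x := ‖X‖) (by rw [abs_of_nonneg hX0]; exact hX1)
      have h4 : Real.exp ‖X‖ - 1 - ‖X‖ ≤ ‖X‖ ^ 2 := (le_abs_self _).trans h3
      nlinarith
    have hcond : 100 * ((((P.d + 2) * P.L : ℕ) : ℝ) * (Real.exp ‖X‖ - 1)) ≤ ρ := by
      have h8 : 100 * ((((P.d + 2) * P.L : ℕ) : ℝ) * (2 * ‖X‖)) ≤ ρ := by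
        have : ‖X‖ * (800 * (((P.d + 2) * P.L : ℕ) : ℝ)) ≤ ρ := by rwa [hr₀, le_div_iff₀ (by positivity)] at hX
        nlinarith
      exact le_trans (by gcongr) h8
    have h := norm_coe_chartRead_le U₀ c hρ (hα c) hα4 hρ0 X hcond
    have hstep : 54 * ((((P.d + 2) * P.L : ℕ) : ℝ) * (Real.exp ‖X‖ - 1)) ≤ 108 * (((P.d + 2) * P.L : ℕ) : ℝ) * ‖X‖ := by
      have hℓ0 : (0 : ℝ) ≤ (((P.d + 2) * P.L : ℕ) : ℝ) := by positivity
      nlinarith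
    have hcoef : 108 * (((P.d + 2) * P.L : ℕ) : ℝ) * ‖X‖ ≤ 560 / ρ * (((P.d + 2) * P.L : ℕ) : ℝ) * ‖X‖ := by
      have h1 : (108 : ℝ) ≤ 560 / ρ := by rw [le_div_iff₀ hρ0]; nlinarith
      have : 0 ≤ (((P.d + 2) * P.L : ℕ) : ℝ) * ‖X‖ := by positivity
      nlinarith
    linarith
  · rw [not_le] at hX
    have h1 := norm_coe_logChart_le_log_two (N := N)
      (avgFun (expMeanLogSU (n := Fin N)) (fun b => (isChartRep_specialUnitaryGroup (n := Fin N)).expChart (X b) * U₀ b) c * (avgFun (expMeanLogSU (n := Fin N)) U₀ c)⁻¹)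
    have hlog : Real.log 2 ≤ 0.7 := by have := Real.log_two_lt_d9; linarith
    have hq : 0.7 ≤ 0.7 * (‖X‖ / r₀) := by
      have : 1 ≤ ‖X‖ / r₀ := by rw [le_div_iff₀ hr₀0]; linarith
      nlinarith
    have e : 0.7 * (‖X‖ / r₀) = 560 / ρ * (((P.d + 2) * P.L : ℕ) : ℝ) * ‖X‖ := by rw [hr₀]; field_simp; ring
    linarith

/-- ★★ **THE SAME, TWO-BLOCK-LOCAL**: in the standing range `j + 1 ≤ m + K`, EVERY `X`: `‖↑(ψ_{U₀}(X) c)‖ ≤ (560∕ρ)·ℓ·‖X^{(c)}‖` ((D1-loc) ✓`chartRead_apply_local`). [cite: Balaban1985Averaging, Prop. 3 (121) p.36, p.19] -/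
theorem norm_coe_chartRead_le_local_global (hj : j + 1 ≤ P.m + P.K) {α ρ : ℝ} (hρ0 : 0 < ρ) (hρ : ρ ≤ innerRadius (specialUnitaryLogChart (Fin N)))
    (hα : ∀ c i, dist1 (loopHol U₀ c i) ≤ α) (hα4 : 4 * α ≤ ρ) (X : PBond P j → (specialUnitaryLogChart (Fin N)).lie) (c : PBond P (j + 1)) :
    ‖(((isChartRep_specialUnitaryGroup (n := Fin N)).logChart (avgFun (expMeanLogSU (n := Fin N)) (fun b => (isChartRep_specialUnitaryGroup (n := Fin N)).expChart (X b) * U₀ b) c * (avgFun (expMeanLogSU (n := Fin N)) U₀ c)⁻¹) : (specialUnitaryLogChart (Fin N)).lie) : Matrix (Fin N) (Fin N) ℂ)‖ ≤ 560 / ρ * (((P.d + 2) * P.L : ℕ) : ℝ) * ‖(fun b : PBond P j => if blockOf b.src = c.src ∨ blockOf b.src = c.tgt then X b else 0)‖ := by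
  classical
  have hagree : ∀ b : PBond P j, (blockOf b.src = c.src ∨ blockOf b.src = c.tgt) → X b = (fun b : PBond P j => if blockOf b.src = c.src ∨ blockOf b.src = c.tgt then X b else 0) b := fun b hb => by
    simp only [hb, if_true]
  rw [chartRead_apply_local (P := P) (N := N) hj U₀ c hagree]
  exact norm_coe_chartRead_le_global U₀ hρ0 hρ hα hα4 _ c

/-- ★★ **THE SAME ON `SU(2)`**: guard `α ≤ 1∕12`, `j + 1 ≤ m + K`, EVERY `X`: **`‖↑(ψ_{U₀}(X) c)‖ ≤ 1680·ℓ·‖X^{(c)}‖`**. [cite: Balaban1985Averaging, Prop. 3 (121) p.36] -/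
theorem norm_coe_chartRead_le_local_SU2 (hj : j + 1 ≤ P.m + P.K) (U₀ : GaugeField P j (SU 2)) {α : ℝ} (hα : ∀ c i, dist1 (loopHol U₀ c i) ≤ α) (hα12 : α ≤ 1 / 12)
    (X : PBond P j → (specialUnitaryLogChart (Fin 2)).lie) (c : PBond P (j + 1)) :
    ‖(((isChartRep_specialUnitaryGroup (n := Fin 2)).logChart (avgFun (expMeanLogSU (n := Fin 2)) (fun b => (isChartRep_specialUnitaryGroup (n := Fin 2)).expChart (X b) * U₀ b) c * (avgFun (expMeanLogSU (n := Fin 2)) U₀ c)⁻¹) : (specialUnitaryLogChart (Fin 2)).lie) : Matrix (Fin 2) (Fin 2) ℂ)‖ ≤ 1680 * (((P.d + 2) * P.L : ℕ) : ℝ) * ‖(fun b : PBond P j => if blockOf b.src = c.src ∨ blockOf b.src = c.tgt then X b else 0)‖ := by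
  have hρ : (1 / 3 : ℝ) ≤ innerRadius (specialUnitaryLogChart (Fin 2)) := by
    unfold innerRadius; rw [specialUnitaryLogChart_ρ, Fintype.card_fin]; norm_num
  have h := norm_coe_chartRead_le_local_global U₀ hj (by norm_num) hρ hα (by linarith) X c
  have e : (560 / (1 / 3) : ℝ) = 1680 := by norm_num
  rw [e] at h
  exact h

end Value

/-! ## §2 The derivative: `‖↑((Dψ_{U₀}(0) X) c)‖ ≤ 216·ℓ·‖X^{(c)}‖` for every `X` -/

section Deriv

/-- ★★ **TWO-BLOCK-LOCAL LINEAR SIZE OF THE ONE-STEP DERIVATIVE**: in the standing range `j + 1 ≤ m + K`, EVERY `X`: **`‖↑((Dψ_{U₀}(0) X) c)‖ ≤ 216·ℓ·‖X^{(c)}‖`** ((β-3)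
✓`norm_coe_fderiv_chartRead_le` at the truncation; (D1-loc) ✓`fderiv_chartRead_apply_local`). [cite: Balaban1985Averaging, Prop. 3 (124)-(126) p.36, p.19] -/
theorem norm_coe_fderiv_chartRead_le_local (hj : j + 1 ≤ P.m + P.K) {α ρ : ℝ} (hρ0 : 0 < ρ) (hρ : ρ ≤ innerRadius (specialUnitaryLogChart (Fin N)))
    (hα : ∀ c i, dist1 (loopHol U₀ c i) ≤ α) (hα4 : 4 * α ≤ ρ) (X : PBond P j → (specialUnitaryLogChart (Fin N)).lie) (c : PBond P (j + 1)) :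
    ‖((fderiv ℝ (fun (A : PBond P j → (specialUnitaryLogChart (Fin N)).lie) (c : PBond P (j + 1)) => (isChartRep_specialUnitaryGroup (n := Fin N)).logChart (avgFun (expMeanLogSU (n := Fin N)) (fun b => (isChartRep_specialUnitaryGroup (n := Fin N)).expChart (A b) * U₀ b) c * (avgFun (expMeanLogSU (n := Fin N)) U₀ c)⁻¹)) 0 X c : (specialUnitaryLogChart (Fin N)).lie) : Matrix (Fin N) (Fin N) ℂ)‖ ≤ 216 * (((P.d + 2) * P.L : ℕ) : ℝ) * ‖(fun b : PBond P j => if blockOf b.src = c.src ∨ blockOf b.src = c.tgt then X b else 0)‖ := by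
  classical
  have hαδ : α < deltaSU (Fin N) := by linarith [hρ.trans (innerRadius_le_deltaSU (N := N)), deltaSU_pos (n := Fin N)]
  have hsmall : ∀ c, Small (expMeanLogSU (n := Fin N)) U₀ c := fun c i => lt_of_le_of_lt (hα c i) hαδ
  have hagree : ∀ b : PBond P j, (blockOf b.src = c.src ∨ blockOf b.src = c.tgt) → X b = (fun b : PBond P j => if blockOf b.src = c.src ∨ blockOf b.src = c.tgt then X b else 0) b := fun b hb => by
    simp only [hb, if_true]
  rw [fderiv_chartRead_apply_local (P := P) (N := N) hj U₀ hsmall c hagree]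
  exact norm_coe_fderiv_chartRead_le U₀ hρ0 hρ hα hα4 _ c

/-- ★★ **THE SAME ON `SU(2)`** (guard `α ≤ 1∕12`; no `ρ` in the constant): EVERY `X`: `‖↑((Dψ_{U₀}(0) X) c)‖ ≤ 216·ℓ·‖X^{(c)}‖`. [cite: Balaban1985Averaging, Prop. 3 (124)-(126) p.36] -/
theorem norm_coe_fderiv_chartRead_le_local_SU2 (hj : j + 1 ≤ P.m + P.K) (U₀ : GaugeField P j (SU 2)) {α : ℝ} (hα : ∀ c i, dist1 (loopHol U₀ c i) ≤ α) (hα12 : α ≤ 1 / 12)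
    (X : PBond P j → (specialUnitaryLogChart (Fin 2)).lie) (c : PBond P (j + 1)) :
    ‖((fderiv ℝ (fun (A : PBond P j → (specialUnitaryLogChart (Fin 2)).lie) (c : PBond P (j + 1)) => (isChartRep_specialUnitaryGroup (n := Fin 2)).logChart (avgFun (expMeanLogSU (n := Fin 2)) (fun b => (isChartRep_specialUnitaryGroup (n := Fin 2)).expChart (A b) * U₀ b) c * (avgFun (expMeanLogSU (n := Fin 2)) U₀ c)⁻¹)) 0 X c : (specialUnitaryLogChart (Fin 2)).lie) : Matrix (Fin 2) (Fin 2) ℂ)‖ ≤ 216 * (((P.d + 2) * P.L : ℕ) : ℝ) * ‖(fun b : PBond P j => if blockOf b.src = c.src ∨ blockOf b.src = c.tgt then X b else 0)‖ := by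
  have hρ : (1 / 3 : ℝ) ≤ innerRadius (specialUnitaryLogChart (Fin 2)) := by
    unfold innerRadius; rw [specialUnitaryLogChart_ρ, Fintype.card_fin]; norm_num
  exact norm_coe_fderiv_chartRead_le_local U₀ hj (by norm_num) hρ hα (by linarith) X c

end Deriv

end Summit.QuantumFields.YangMills.Theorems.FluctuationComparisonRegPrIntLS2BetaChartReadGlobalSizes

end
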